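import Summits.RiemannHypothesis.RiemannHypothesis.Theorems.TiltedLandingLaw421E3Lineage

/-! # TiltedLandingLaw421E3Cell
W-07 E3 §E/§E2/§E3/§E4 THE (iv) CELL (C1 rh-idea-5 g21; `sectionE` 960be626, `sectionE2` 76732859, `sectionE3` 021204c8, `sectionE4` 51a10681): `SlackCellG`, `PenalisedCensusG`,
★★`slackCellG_iff_penalised`, `E3Cell`, `NamedCellG`/`E3CellS S`, `denseLevelCensusStopLow_of_e3CellS`, `descentSigS'_of_e3CellS`, c9 `lineageLawG_iff_sigmaMin_le`, `restBudgetG_anti_sigma`,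
`runMax`, ★`paceMeter`, `lineageLawG_pace`, `sigmaMin_le_paceMeter`, ★★`e3CellS_pace_of_rest`. README: `pub/ideators/rh-idea-5/g21/w07e3/README-sectionS-E-E4.md`.
SUPPORT module for crux `TiltedLandingLaw421` (stmt-RiemannHypothesis-24774), `--supports` only: proves no stub, no crux; fully proved (no `sorry`).
Cut by tenure rh-tenure-earlyapp-1 g4 per director (CA261)(C2) from the authors' farm-checked sections (decl blocks byte-verbatim; section `/-! -/` prose and
`#print axioms` lines dropped, mechanical docstrings added where absent); K = kernel-checked lemmas about MODEL sockets (combs), not ζ/Ξ. RH is not proved. -/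

namespace RhW07.E3.Cell

open Complex
open RhIdea6.G17.W07C7 RhIdea6.G17.W07C7.Rev6 RhIdea6.G18.W07C8.Law421BirthS RhIdea6.G19.W07C11.Seam
open RhIdea6.G20.W07C12.Frac RhIdea6.G20.W07C12.StColP RhW07.C12.FieldSplit RhIdea6.G21.W07C13.TentMax
open RhW07.C14.TwoSided RhW07.C14.Classes RhW07.C14.Lineage RhW07.C14.Booking

/-- the (iv) cell of record at the SLACK budget with the settler meter existential, non-negative and billed. -/
def SlackCellG (μ cE : ℝ) (P St Ready : StatePred) (𝓔 : LevelClass) (M : LevelMeter) : Prop :=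
  ∃ σ : LevelMeter, (∀ (η : ℝ) (f : ℂ → ℂ) (x₀ s hmax R Hs : ℝ) (B k : ℕ), 0 ≤ σ η f x₀ s hmax R Hs B k) ∧
    LineageLawG P St Ready 𝓔 σ M ∧ RestBudgetG μ P St Ready 𝓔 σ (slackBudget cE M) M

open Classical in
/-- the PENALISED CENSUS at class 𝓔 with booking `M … 0`: cost with non-𝓔 charged levels counted as injections, floored at the booking. -/
def PenalisedCensusG (μ cE : ℝ) (P St Ready : StatePred) (𝓔 : LevelClass) (M : LevelMeter) : Prop :=
  ∀ (η : ℝ) (f : ℂ → ℂ) (x₀ s hmax R Hs : ℝ) (B : ℕ), EngineHyps5 2 η f x₀ s hmax R Hs B →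
    ∃ lam : ℕ → ℝ, (∀ j : ℕ, 0 ≤ lam j) ∧
      (∀ j : ℕ, Charged P St Ready η f x₀ s hmax R Hs B j →
        ∀ u : ℂ, St η f x₀ s hmax R Hs B j u → ¬ Ready η f x₀ s hmax R Hs B j u →
          ∃ u' : ℂ, St η f x₀ s hmax R Hs B (j + 1) u' ∧ |u'.im| ≤ |u.im| + lam j) ∧
      ∀ k : ℕ, max (injected P St Ready 𝓔 η f x₀ s hmax R Hs B k) (M η f x₀ s hmax R Hs B 0)
          + (∑ j ∈ Finset.range k, (if Charged P St Ready η f x₀ s hmax R Hs B j then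
              (if 𝓔 η f x₀ s hmax R Hs B j then (1 : ℝ) else 0) + lam j / (μ * s) else 0))
        ≤ (Hs / s) ^ 2 + B + cE

/-- MINIMAL SETTLERS: `(injected − M 0)⁺`. -/
noncomputable def sigmaMin (P St Ready : StatePred) (𝓔 : LevelClass) (M : LevelMeter) : LevelMeter := fun η f x₀ s hmax R Hs B k =>
  max (injected P St Ready 𝓔 η f x₀ s hmax R Hs B k - M η f x₀ s hmax R Hs B 0) 0

/-- (K, arithmetic) -/
theorem max_add_le_iff {a m r p : ℝ} : max a m + r ≤ p ↔ (a + r ≤ p ∧ m + r ≤ p) := by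
  constructor
  · intro h
    exact ⟨by have := le_max_left a m; linarith, by have := le_max_right a m; linarith⟩
  · rintro ⟨h1, h2⟩
    rcases le_total a m with h | h
    · rw [max_eq_right h]; exact h2
    · rw [max_eq_left h]; exact h1

open Classical in
/-- ★★ (K) **THE (iv) CELL AT THE SLACK BUDGET IS THE PENALISED CENSUS.** -/
theorem slackCellG_iff_penalised {μ cE : ℝ} {P St Ready : StatePred} {𝓔 : LevelClass} {M : LevelMeter} :
    SlackCellG μ cE P St Ready 𝓔 M ↔ PenalisedCensusG μ cE P St Ready 𝓔 M := by
  constructor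
  · rintro ⟨σ, hσ, hL, hR⟩ η f x₀ s hmax R Hs B hE
    obtain ⟨lam, hlam0, hsucc, hrest⟩ := hR η f x₀ s hmax R Hs B hE
    refine ⟨lam, hlam0, hsucc, fun k => ?_⟩
    have h1 : injected P St Ready 𝓔 η f x₀ s hmax R Hs B k ≤ M η f x₀ s hmax R Hs B 0 + σ η f x₀ s hmax R Hs B k :=
      hL η f x₀ s hmax R Hs B hE k
    have h2 : σ η f x₀ s hmax R Hs B k + _ ≤ (Hs / s) ^ 2 + (B : ℝ) + cE - M η f x₀ s hmax R Hs B 0 := hrest k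
    have h3 := hσ η f x₀ s hmax R Hs B k
    exact max_add_le_iff.mpr ⟨by linarith, by linarith⟩
  · intro h
    refine ⟨sigmaMin P St Ready 𝓔 M, fun η f x₀ s hmax R Hs B k => le_max_right _ _, ?_, ?_⟩
    · intro η f x₀ s hmax R Hs B hE k
      show injected P St Ready 𝓔 η f x₀ s hmax R Hs B k
        ≤ M η f x₀ s hmax R Hs B 0 + max (injected P St Ready 𝓔 η f x₀ s hmax R Hs B k - M η f x₀ s hmax R Hs B 0) 0
      have := le_max_left (injected P St Ready 𝓔 η f x₀ s hmax R Hs B k - M η f x₀ s hmax R Hs B 0) (0 : ℝ)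
      linarith
    · intro η f x₀ s hmax R Hs B hE
      obtain ⟨lam, hlam0, hsucc, hpen⟩ := h η f x₀ s hmax R Hs B hE
      refine ⟨lam, hlam0, hsucc, fun k => ?_⟩
      obtain ⟨hA, hB⟩ := max_add_le_iff.mp (hpen k)
      have e1 : sigmaMin P St Ready 𝓔 M η f x₀ s hmax R Hs B k
          = max (injected P St Ready 𝓔 η f x₀ s hmax R Hs B k - M η f x₀ s hmax R Hs B 0) 0 := rfl
      have e2 : slackBudget cE M η f x₀ s hmax R Hs B = (Hs / s) ^ 2 + (B : ℝ) + cE - M η f x₀ s hmax R Hs B 0 := rfl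
      rw [e1, e2]
      exact max_add_le_iff.mpr ⟨by linarith, by linarith⟩

/-- (K) the slack cell ⇒ (β-low) at any class and booking (INIT♯ is automatic at the slack budget). -/
theorem denseLevelCensusLow_of_slackCell {μ cE : ℝ} (hμ : 0 < μ) {P St Ready : StatePred} {𝓔 : LevelClass} {M : LevelMeter}
    (h : SlackCellG μ cE P St Ready 𝓔 M) : DenseLevelCensusLow μ cE P St Ready := by
  obtain ⟨σ, -, hL, hR⟩ := h
  exact census_of_lineage hμ (initSharpG_slack cE M) hL hR

/-- (K) … and the prefix law with the virtual reserve booked by the minimal settlers' cell (via §S). -/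
theorem prefixG_of_slackCell {μ cE : ℝ} {P St Ready : StatePred} {𝓔 : LevelClass} {M : LevelMeter}
    (h : SlackCellG μ cE P St Ready 𝓔 M) : ∃ σ : LevelMeter, MonovariantPrefixG μ cE P St Ready (bookingMeter P St Ready 𝓔 σ M) := by
  obtain ⟨σ, -, hL, hR⟩ := h
  exact ⟨σ, prefixG_of_lineage (initSharpG_slack cE M) hL hR⟩

/-- (K) monotone in 𝓔 on the LAW side only: the slack cell at 𝓔 needs LAW at 𝓔 but tolerates REST proved at any LARGER class. -/
theorem slackCellG_of_trade {μ cE : ℝ} {P St Ready : StatePred} {𝓔 𝓔₂ : LevelClass} {M : LevelMeter}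
    (h₂ : ∀ η f x₀ s hmax R Hs B j, 𝓔 η f x₀ s hmax R Hs B j → 𝓔₂ η f x₀ s hmax R Hs B j)
    {σ : LevelMeter} (hσ : ∀ (η : ℝ) (f : ℂ → ℂ) (x₀ s hmax R Hs : ℝ) (B k : ℕ), 0 ≤ σ η f x₀ s hmax R Hs B k)
    (hL : LineageLawG P St Ready 𝓔 σ M) (hR : RestBudgetG μ P St Ready 𝓔₂ σ (slackBudget cE M) M) : SlackCellG μ cE P St Ready 𝓔 M :=
  ⟨σ, hσ, hL, restBudgetG_anti_E h₂ hR⟩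

/-- ★ **THE E3 CANDIDATE OF RECORD (CA255)**: (iv) LINEAGE LAW ∧ REST with 𝓔″ := EMPTY-only, booking = the raw sealed tent `T₀^max(3/2)`, settlers
minimal and billed, budget `S₀ = purse − T₀`, literals μ = 1/4, cE = 1, `P = PSealC4`, `St = StCol'`, `Ready = CumReady WindowReady`. -/
def E3Cell : Prop :=
  SlackCellG (1 / 4) 1 PSealC4 StCol' (CumReady WindowReady) (EmptyClass (3 / 2)) (tentMeterMax (3 / 2))

/-- ★ (K) its kernel reading: the penalised census at EMPTY-only with the raw-tent booking. -/
theorem e3Cell_iff_penalised :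
    E3Cell ↔ PenalisedCensusG (1 / 4) 1 PSealC4 StCol' (CumReady WindowReady) (EmptyClass (3 / 2)) (tentMeterMax (3 / 2)) :=
  slackCellG_iff_penalised

/-- ★ (K) E3 ⇒ the registered (β-low) stub's statement `DenseLevelCensusStopLow PSealC4`. -/
theorem denseLevelCensusStopLow_of_e3Cell (h : E3Cell) : DenseLevelCensusStopLow PSealC4 :=
  denseLevelCensusLow_of_slackCell (by norm_num) h

/-- (K) … and with the hand (α-low) on to `DescentSigS'`. -/
theorem descentSigS'_of_e3Cell (h : E3Cell) (hα : IsolatedPairDropLow PSealC4) : DescentSigS' :=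
  descentSigS'_of_fieldSplitLowLow hα (denseLevelCensusStopLow_of_e3Cell h)

/-- (K) how E3 is ASSEMBLED from its two research halves: LAW at EMPTY-only (C4 §I's target with ρ = 3/2) and REST at EMPTY-only — or at any
larger class, e.g. C6's LSE bank if it were clean — with one common non-negative settler meter. -/
theorem e3Cell_of_halves {𝓔₂ : LevelClass}
    (h₂ : ∀ η f x₀ s hmax R Hs B j, EmptyClass (3 / 2) η f x₀ s hmax R Hs B j → 𝓔₂ η f x₀ s hmax R Hs B j)
    {σ : LevelMeter} (hσ : ∀ (η : ℝ) (f : ℂ → ℂ) (x₀ s hmax R Hs : ℝ) (B k : ℕ), 0 ≤ σ η f x₀ s hmax R Hs B k)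
    (hL : LineageLaw PSealC4 (EmptyClass (3 / 2)) σ (tentMeterMax (3 / 2)))
    (hR : RestBudget PSealC4 𝓔₂ σ (slackBudget 1 (tentMeterMax (3 / 2))) (tentMeterMax (3 / 2))) : E3Cell :=
  slackCellG_of_trade h₂ hσ hL hR
end RhW07.E3.Cell

namespace RhW07.E3.Cell

open RhIdea6.G17.W07C7 RhIdea6.G17.W07C7.Rev6 RhIdea6.G18.W07C8.Law421BirthS RhIdea6.G19.W07C11.Seam
open RhIdea6.G20.W07C12.Frac RhIdea6.G20.W07C12.StColP RhW07.C12.FieldSplit RhIdea6.G21.W07C13.TentMax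
open RhW07.C14.TwoSided RhW07.C14.Classes RhW07.C14.Lineage RhW07.C14.Booking

/-- generic c9-shape: the (iv) cell at the slack budget with a GIVEN settler meter `S` (non-negativity is part of the claim about `S`). -/
def NamedCellG (μ cE : ℝ) (P St Ready : StatePred) (𝓔 : LevelClass) (S M : LevelMeter) : Prop :=
  (∀ (η : ℝ) (f : ℂ → ℂ) (x₀ s hmax R Hs : ℝ) (B k : ℕ), 0 ≤ S η f x₀ s hmax R Hs B k) ∧
    LineageLawG P St Ready 𝓔 S M ∧ RestBudgetG μ P St Ready 𝓔 S (slackBudget cE M) M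

/-- (K) named ⇒ existential (the penalised-census envelope); the converse is the c9 costume and is NOT a theorem. -/
theorem slackCellG_of_named {μ cE : ℝ} {P St Ready : StatePred} {𝓔 : LevelClass} {S M : LevelMeter}
    (h : NamedCellG μ cE P St Ready 𝓔 S M) : SlackCellG μ cE P St Ready 𝓔 M :=
  ⟨S, h.1, h.2.1, h.2.2⟩

/-- (K) every named cell satisfies the penalised census (the envelope bounds what ANY named `S` can afford). -/
theorem penalised_of_named {μ cE : ℝ} {P St Ready : StatePred} {𝓔 : LevelClass} {S M : LevelMeter}
    (h : NamedCellG μ cE P St Ready 𝓔 S M) : PenalisedCensusG μ cE P St Ready 𝓔 M :=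
  slackCellG_iff_penalised.mp (slackCellG_of_named h)

/-- ★ **(CA255) c9-COMPLIANT, PARAMETRIC IN THE SETTLER FUNCTIONAL `S`**: 𝓔″ = `EmptyClass (3/2)`, booking `tentMeterMax (3/2)`, β = S₀, literals. -/
def E3CellS (S : LevelMeter) : Prop :=
  NamedCellG (1 / 4) 1 PSealC4 StCol' (CumReady WindowReady) (EmptyClass (3 / 2)) S (tentMeterMax (3 / 2))

/-- (K) `E3CellS S → E3Cell`. -/
theorem e3Cell_of_e3CellS {S : LevelMeter} (h : E3CellS S) : E3Cell := slackCellG_of_named h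

/-- (K) `E3CellS S` ⇒ the registered (β-low) stub's statement, and with the hand (α-low) ⇒ `DescentSigS'`. -/
theorem denseLevelCensusStopLow_of_e3CellS {S : LevelMeter} (h : E3CellS S) : DenseLevelCensusStopLow PSealC4 :=
  denseLevelCensusStopLow_of_e3Cell (e3Cell_of_e3CellS h)

/-- W-07 E3 support (E02 §E2, C1 rh-idea-5 g21): see the module docstring and the source README. -/
theorem descentSigS'_of_e3CellS {S : LevelMeter} (h : E3CellS S) (hα : IsolatedPairDropLow PSealC4) : DescentSigS' :=
  descentSigS'_of_e3Cell (e3Cell_of_e3CellS h) hα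

/-- (K) assembly of `E3CellS S` from its two research halves with the SAME named `S` (REST may be proved at any class ⊇ EMPTY-only). -/
theorem e3CellS_of_halves {S : LevelMeter} {𝓔₂ : LevelClass}
    (h₂ : ∀ η f x₀ s hmax R Hs B j, EmptyClass (3 / 2) η f x₀ s hmax R Hs B j → 𝓔₂ η f x₀ s hmax R Hs B j)
    (hS : ∀ (η : ℝ) (f : ℂ → ℂ) (x₀ s hmax R Hs : ℝ) (B k : ℕ), 0 ≤ S η f x₀ s hmax R Hs B k)
    (hL : LineageLaw PSealC4 (EmptyClass (3 / 2)) S (tentMeterMax (3 / 2)))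
    (hR : RestBudget PSealC4 𝓔₂ S (slackBudget 1 (tentMeterMax (3 / 2))) (tentMeterMax (3 / 2))) : E3CellS S :=
  ⟨hS, hL, restBudgetG_anti_E h₂ hR⟩
end RhW07.E3.Cell

namespace RhW07.E3.Cell

open RhIdea6.G17.W07C7 RhIdea6.G17.W07C7.Rev6 RhIdea6.G18.W07C8.Law421BirthS RhIdea6.G19.W07C11.Seam
open RhIdea6.G20.W07C12.Frac RhIdea6.G20.W07C12.StColP RhW07.C12.FieldSplit RhIdea6.G21.W07C13.TentMax
open RhW07.C14.TwoSided RhW07.C14.Classes RhW07.C14.Lineage RhW07.C14.Booking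

/-- ★ (K) (ii): for `S ≥ 0` the lineage law is EXACTLY pointwise domination of `σ_min`. -/
theorem lineageLawG_iff_sigmaMin_le {P St Ready : StatePred} {𝓔 : LevelClass} {S M : LevelMeter}
    (hS : ∀ (η : ℝ) (f : ℂ → ℂ) (x₀ s hmax R Hs : ℝ) (B k : ℕ), 0 ≤ S η f x₀ s hmax R Hs B k) :
    LineageLawG P St Ready 𝓔 S M ↔
      ∀ (η : ℝ) (f : ℂ → ℂ) (x₀ s hmax R Hs : ℝ) (B : ℕ), EngineHyps5 2 η f x₀ s hmax R Hs B →
        ∀ k : ℕ, sigmaMin P St Ready 𝓔 M η f x₀ s hmax R Hs B k ≤ S η f x₀ s hmax R Hs B k := by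
  rw [lineageLawG_iff_booking_nonneg]
  constructor
  · intro h η f x₀ s hmax R Hs B hE k
    have h1 : 0 ≤ M η f x₀ s hmax R Hs B 0 + S η f x₀ s hmax R Hs B k - injected P St Ready 𝓔 η f x₀ s hmax R Hs B k :=
      h η f x₀ s hmax R Hs B hE k
    show max (injected P St Ready 𝓔 η f x₀ s hmax R Hs B k - M η f x₀ s hmax R Hs B 0) 0 ≤ S η f x₀ s hmax R Hs B k
    exact max_le (by linarith) (hS η f x₀ s hmax R Hs B k)
  · intro h η f x₀ s hmax R Hs B hE k
    have h1 : max (injected P St Ready 𝓔 η f x₀ s hmax R Hs B k - M η f x₀ s hmax R Hs B 0) 0 ≤ S η f x₀ s hmax R Hs B k :=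
      h η f x₀ s hmax R Hs B hE k
    have h2 := le_max_left (injected P St Ready 𝓔 η f x₀ s hmax R Hs B k - M η f x₀ s hmax R Hs B 0) 0
    show 0 ≤ M η f x₀ s hmax R Hs B 0 + S η f x₀ s hmax R Hs B k - injected P St Ready 𝓔 η f x₀ s hmax R Hs B k
    linarith

/-- (K) the c9 corner: `σ_min` satisfies the law BY DEFINITION. -/
theorem lineageLawG_sigmaMin {P St Ready : StatePred} {𝓔 : LevelClass} {M : LevelMeter} :
    LineageLawG P St Ready 𝓔 (sigmaMin P St Ready 𝓔 M) M := by
  rw [lineageLawG_iff_booking_nonneg]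
  intro η f x₀ s hmax R Hs B hE k
  have h2 := le_max_left (injected P St Ready 𝓔 η f x₀ s hmax R Hs B k - M η f x₀ s hmax R Hs B 0) 0
  show 0 ≤ M η f x₀ s hmax R Hs B 0 + sigmaMin P St Ready 𝓔 M η f x₀ s hmax R Hs B k - injected P St Ready 𝓔 η f x₀ s hmax R Hs B k
  unfold sigmaMin
  linarith

/-- (K) (iii): REST is ANTITONE in the settler meter (each booked settler costs 1). -/
theorem restBudgetG_anti_sigma {μ : ℝ} {P St Ready : StatePred} {𝓔 : LevelClass} {σ σ' : LevelMeter} {β : Budget} {M : LevelMeter}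
    (hle : ∀ (η : ℝ) (f : ℂ → ℂ) (x₀ s hmax R Hs : ℝ) (B k : ℕ), σ' η f x₀ s hmax R Hs B k ≤ σ η f x₀ s hmax R Hs B k)
    (h : RestBudgetG μ P St Ready 𝓔 σ β M) : RestBudgetG μ P St Ready 𝓔 σ' β M := by
  intro η f x₀ s hmax R Hs B hE
  obtain ⟨lam, hlam0, hsucc, hrest⟩ := h η f x₀ s hmax R Hs B hE
  refine ⟨lam, hlam0, hsucc, fun k => ?_⟩
  have h1 := hrest k
  have h2 := hle η f x₀ s hmax R Hs B k
  linarith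

/-- ★ (K) REST with a law-abiding named `S ≥ 0` ⇒ REST with `σ_min` (same β, 𝓔, M); converse fails in general. -/
theorem restBudgetG_sigmaMin_of_named {μ : ℝ} {P St Ready : StatePred} {𝓔 : LevelClass} {S : LevelMeter} {β : Budget} {M : LevelMeter}
    (hS : ∀ (η : ℝ) (f : ℂ → ℂ) (x₀ s hmax R Hs : ℝ) (B k : ℕ), 0 ≤ S η f x₀ s hmax R Hs B k)
    (hL : LineageLawG P St Ready 𝓔 S M) (hR : RestBudgetG μ P St Ready 𝓔 S β M) :
    RestBudgetG μ P St Ready 𝓔 (sigmaMin P St Ready 𝓔 M) β M := by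
  intro η f x₀ s hmax R Hs B hE
  obtain ⟨lam, hlam0, hsucc, hrest⟩ := hR η f x₀ s hmax R Hs B hE
  refine ⟨lam, hlam0, hsucc, fun k => ?_⟩
  have h1 := hrest k
  have h2 := (lineageLawG_iff_sigmaMin_le hS).mp hL η f x₀ s hmax R Hs B hE k
  linarith
end RhW07.E3.Cell

namespace RhW07.E3.Cell

open RhIdea6.G17.W07C7 RhIdea6.G17.W07C7.Rev6 RhIdea6.G18.W07C8.Law421BirthS RhIdea6.G19.W07C11.Seam
open RhIdea6.G20.W07C12.Frac RhIdea6.G20.W07C12.StColP RhW07.C12.FieldSplit RhIdea6.G21.W07C13.TentMax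
open RhW07.C14.TwoSided RhW07.C14.Classes RhW07.C14.Lineage RhW07.C14.Booking

/-- running maximum of `g 0, …, g k`, floored at `0`. -/
def runMax (g : ℕ → ℝ) : ℕ → ℝ
  | 0 => max (g 0) 0
  | k + 1 => max (runMax g k) (g (k + 1))

/-- W-07 E3 support (E02 §E4, C1 rh-idea-5 g21): see the module docstring and the source README. -/
theorem runMax_nonneg (g : ℕ → ℝ) : ∀ k : ℕ, 0 ≤ runMax g k
  | 0 => le_max_right _ _
  | k + 1 => le_trans (runMax_nonneg g k) (le_max_left _ _)

/-- W-07 E3 support (E02 §E4, C1 rh-idea-5 g21): see the module docstring and the source README. -/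
theorem le_runMax (g : ℕ → ℝ) : ∀ k : ℕ, g k ≤ runMax g k
  | 0 => le_max_left _ _
  | _ + 1 => le_max_right _ _

/-- W-07 E3 support (E02 §E4, C1 rh-idea-5 g21): see the module docstring and the source README. -/
theorem runMax_le_succ (g : ℕ → ℝ) (k : ℕ) : runMax g k ≤ runMax g (k + 1) := le_max_left _ _

/-- (K) the sup characterisation. -/
theorem runMax_le_iff (g : ℕ → ℝ) (b : ℝ) : ∀ k : ℕ, runMax g k ≤ b ↔ (0 ≤ b ∧ ∀ k' : ℕ, k' ≤ k → g k' ≤ b)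
  | 0 => by
      show max (g 0) 0 ≤ b ↔ _
      rw [max_le_iff]
      constructor
      · rintro ⟨h1, h0⟩
        refine ⟨h0, fun k' hk' => ?_⟩
        rw [Nat.le_zero.mp hk']
        exact h1
      · rintro ⟨h0, h⟩
        exact ⟨h 0 le_rfl, h0⟩
  | k + 1 => by
      show max (runMax g k) (g (k + 1)) ≤ b ↔ _
      rw [max_le_iff, runMax_le_iff g b k]
      constructor
      · rintro ⟨⟨h0, h⟩, h1⟩
        refine ⟨h0, fun k' hk' => ?_⟩
        rcases Nat.lt_or_ge k' (k + 1) with hlt | hge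
        · exact h k' (Nat.lt_succ_iff.mp hlt)
        · rw [le_antisymm hk' hge]
          exact h1
      · rintro ⟨h0, h⟩
        exact ⟨⟨h0, fun k' hk' => h k' (Nat.le_succ_of_le hk')⟩, h (k + 1) le_rfl⟩

/-- ★ the PACE METER of a named exit meter `D`: the running deficit of injections against `D`, floored at 0. -/
noncomputable def paceMeter (P St Ready : StatePred) (𝓔 : LevelClass) (D : LevelMeter) : LevelMeter := fun η f x₀ s hmax R Hs B k =>
  runMax (fun k' => injected P St Ready 𝓔 η f x₀ s hmax R Hs B k' - D η f x₀ s hmax R Hs B k') k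

/-- W-07 E3 support (E02 §E4, C1 rh-idea-5 g21): see the module docstring and the source README. -/
theorem paceMeter_nonneg (P St Ready : StatePred) (𝓔 : LevelClass) (D : LevelMeter) (η : ℝ) (f : ℂ → ℂ) (x₀ s hmax R Hs : ℝ) (B k : ℕ) :
    0 ≤ paceMeter P St Ready 𝓔 D η f x₀ s hmax R Hs B k := runMax_nonneg _ k

/-- W-07 E3 support (E02 §E4, C1 rh-idea-5 g21): see the module docstring and the source README. -/
theorem paceMeter_mono (P St Ready : StatePred) (𝓔 : LevelClass) (D : LevelMeter) (η : ℝ) (f : ℂ → ℂ) (x₀ s hmax R Hs : ℝ) (B k : ℕ) :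
    paceMeter P St Ready 𝓔 D η f x₀ s hmax R Hs B k ≤ paceMeter P St Ready 𝓔 D η f x₀ s hmax R Hs B (k + 1) := runMax_le_succ _ k

/-- (K) RIDER-34's Hall / greedy form: `paceMeter D … k ≤ b` iff `b ≥ 0` and `injected k′ ≤ D k′ + b` for every `k′ ≤ k`. -/
theorem paceMeter_le_iff (P St Ready : StatePred) (𝓔 : LevelClass) (D : LevelMeter) (η : ℝ) (f : ℂ → ℂ) (x₀ s hmax R Hs : ℝ) (B k : ℕ) (b : ℝ) :
    paceMeter P St Ready 𝓔 D η f x₀ s hmax R Hs B k ≤ b ↔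
      (0 ≤ b ∧ ∀ k' : ℕ, k' ≤ k → injected P St Ready 𝓔 η f x₀ s hmax R Hs B k' - D η f x₀ s hmax R Hs B k' ≤ b) :=
  runMax_le_iff _ b k

/-- ★ (K) «LAW AUTOMATIC» (RIDER-35 (3)): if the exit meter never exceeds the level-0 booking, the pace meter satisfies the lineage law. -/
theorem lineageLawG_pace {P St Ready : StatePred} {𝓔 : LevelClass} {D M : LevelMeter}
    (hD : ∀ (η : ℝ) (f : ℂ → ℂ) (x₀ s hmax R Hs : ℝ) (B : ℕ), EngineHyps5 2 η f x₀ s hmax R Hs B →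
      ∀ k : ℕ, D η f x₀ s hmax R Hs B k ≤ M η f x₀ s hmax R Hs B 0) :
    LineageLawG P St Ready 𝓔 (paceMeter P St Ready 𝓔 D) M := by
  rw [lineageLawG_iff_booking_nonneg]
  intro η f x₀ s hmax R Hs B hE k
  have h1 : injected P St Ready 𝓔 η f x₀ s hmax R Hs B k - D η f x₀ s hmax R Hs B k ≤ paceMeter P St Ready 𝓔 D η f x₀ s hmax R Hs B k :=
    le_runMax (fun k' => injected P St Ready 𝓔 η f x₀ s hmax R Hs B k' - D η f x₀ s hmax R Hs B k') k
  have h2 := hD η f x₀ s hmax R Hs B hE k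
  show 0 ≤ M η f x₀ s hmax R Hs B 0 + paceMeter P St Ready 𝓔 D η f x₀ s hmax R Hs B k - injected P St Ready 𝓔 η f x₀ s hmax R Hs B k
  linarith

/-- (K) … hence it dominates the minimal settlers (§E3): `σ_min ≤ paceMeter D`. -/
theorem sigmaMin_le_paceMeter {P St Ready : StatePred} {𝓔 : LevelClass} {D M : LevelMeter}
    (hD : ∀ (η : ℝ) (f : ℂ → ℂ) (x₀ s hmax R Hs : ℝ) (B : ℕ), EngineHyps5 2 η f x₀ s hmax R Hs B →
      ∀ k : ℕ, D η f x₀ s hmax R Hs B k ≤ M η f x₀ s hmax R Hs B 0)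
    (η : ℝ) (f : ℂ → ℂ) (x₀ s hmax R Hs : ℝ) (B : ℕ) (hE : EngineHyps5 2 η f x₀ s hmax R Hs B) (k : ℕ) :
    sigmaMin P St Ready 𝓔 M η f x₀ s hmax R Hs B k ≤ paceMeter P St Ready 𝓔 D η f x₀ s hmax R Hs B k :=
  (lineageLawG_iff_sigmaMin_le (paceMeter_nonneg P St Ready 𝓔 D)).mp (lineageLawG_pace hD) η f x₀ s hmax R Hs B hE k

/-- ★★ (K) **THE PACE CELL** ((CA255) under C2's instance, shape): for a named exit meter `D ≤ T₀(3/2)`, `E3CellS (paceMeter D)` IS its REST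
half (LAW automatic, meter ≥ 0 by construction; REST may be proved at any class ⊇ EMPTY-only). -/
theorem e3CellS_pace_of_rest {D : LevelMeter} {𝓔₂ : LevelClass}
    (h₂ : ∀ η f x₀ s hmax R Hs B j, EmptyClass (3 / 2) η f x₀ s hmax R Hs B j → 𝓔₂ η f x₀ s hmax R Hs B j)
    (hD : ∀ (η : ℝ) (f : ℂ → ℂ) (x₀ s hmax R Hs : ℝ) (B : ℕ), EngineHyps5 2 η f x₀ s hmax R Hs B →
      ∀ k : ℕ, D η f x₀ s hmax R Hs B k ≤ tentMeterMax (3 / 2) η f x₀ s hmax R Hs B 0)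
    (hR : RestBudget PSealC4 𝓔₂ (paceMeter PSealC4 StCol' (CumReady WindowReady) (EmptyClass (3 / 2)) D)
      (slackBudget 1 (tentMeterMax (3 / 2))) (tentMeterMax (3 / 2))) :
    E3CellS (paceMeter PSealC4 StCol' (CumReady WindowReady) (EmptyClass (3 / 2)) D) :=
  e3CellS_of_halves h₂ (paceMeter_nonneg PSealC4 StCol' (CumReady WindowReady) (EmptyClass (3 / 2)) D) (lineageLawG_pace hD) hR

/-- (K) node readings of the pace cell. -/
theorem descentSigS'_of_pace {D : LevelMeter} {𝓔₂ : LevelClass}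
    (h₂ : ∀ η f x₀ s hmax R Hs B j, EmptyClass (3 / 2) η f x₀ s hmax R Hs B j → 𝓔₂ η f x₀ s hmax R Hs B j)
    (hD : ∀ (η : ℝ) (f : ℂ → ℂ) (x₀ s hmax R Hs : ℝ) (B : ℕ), EngineHyps5 2 η f x₀ s hmax R Hs B →
      ∀ k : ℕ, D η f x₀ s hmax R Hs B k ≤ tentMeterMax (3 / 2) η f x₀ s hmax R Hs B 0)
    (hR : RestBudget PSealC4 𝓔₂ (paceMeter PSealC4 StCol' (CumReady WindowReady) (EmptyClass (3 / 2)) D)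
      (slackBudget 1 (tentMeterMax (3 / 2))) (tentMeterMax (3 / 2)))
    (hα : IsolatedPairDropLow PSealC4) : DescentSigS' :=
  descentSigS'_of_e3CellS (e3CellS_pace_of_rest h₂ hD hR) hα
end RhW07.E3.Cell
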